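import Literature.NumberTheory.Sieve.LinearEquationsInPrimesDimOne

/-!
# Route `ArtinGenericSplit` — definitions for the necessity package (D-0009 Defs file)

decomp-parity node G1.2.A «ArtinGenericSplit» (lens-2 g6; critic CLEARED HOME/STATUS.md l.255, CRITIC-LEDGER row 54;
route born rev 0, commit 5231dbe0a256).  The four auxiliary definitions used by the necessity theorems
`FixedLower → DicksonConjecture → ArtinTwo` (files `ArtinGenericSplitNecessityDickson*.lean`,
`ArtinGenericSplitNecessity.lean`), copied verbatim from the cell kernel
HOME/decomp-parity-lens-2/g6/ArtinGenericSplit.lean @5480cd22e7b9287d (§1, §2, §5) and re-namespaced so that they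
cannot collide with the born route decls `Theses.ArtinGenericSplit.ArtinTwo / ArtinLift`.
-/

namespace Summit.Parity.GeneralizedHardyLittlewood.ArtinGenericSplitNecessity

open Literature.NumberTheory.Sieve

/-- `p` is an *Artin prime for the base 2*: `p` is prime and `2` generates `(ℤ/pℤ)ˣ`
(spelled as in the tree's `lenstra1977_exists_prime_two_primitiveRoot_progression_of_ERH`:
`orderOf (2 : ZMod p) = p - 1`); the born item `ArtinTwo` (stmt-Parity-30686) is
`{p | IsArtinPrime p}.Infinite` up to unfolding. [folklore] -/
def IsArtinPrime (p : ℕ) : Prop := p.Prime ∧ orderOf (2 : ZMod p) = p - 1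

/-- `p` is *special* for the base 2: some prime `ℓ ∣ p − 1` sees `2` as an `ℓ`-th power residue,
i.e. `2^{(p-1)/ℓ} = 1` in `ℤ/p` (equivalently: `p` splits completely in the Kummer field
`ℚ(ζ_ℓ, 2^{1/ℓ})`). [folklore] -/
def IsSpecial (p : ℕ) : Prop := ∃ ℓ : ℕ, ℓ.Prime ∧ ℓ ∣ p - 1 ∧ (2 : ZMod p) ^ ((p - 1) / ℓ) = 1

/-- The Green–Tao system `ψᵢ(n) = aᵢ n + bᵢ` on `ℤ¹` (a dilated linear family). [cite: GreenTao2010, Def. 1.1] -/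
def dsys {t : ℕ} (a b : Fin t → ℕ) : Fin t → AffLinForm 1 := fun i => ⟨fun _ => (a i : ℤ), (b i : ℤ)⟩

/-- The convex body `[0, N] ⊂ ℝ¹`. [folklore] -/
def body (N : ℕ) : Set (Fin 1 → ℝ) := Set.Icc (fun _ : Fin 1 => (0 : ℝ)) (fun _ => (N : ℝ))

end Summit.Parity.GeneralizedHardyLittlewood.ArtinGenericSplitNecessity
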